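import Summits.Parity.BatemanHorn.Theses.AlmostPrimeZeros
import Summits.Parity.BatemanHorn.Theorems.SystemZeroRepulsion.Negative.CruxPairwiseLoadBearing

/-!
# Crux `DiscMajorantLog` (stmt-Parity-17114) — `pairwise_not_associated` is load-bearing

Negative-side theorem (refuter crux attack, 2026-08-17) for the near leaf
`Summit.Parity.BatemanHorn.Theses.AlmostPrimeZeros.DiscMajorantLog` of route `AlmostPrimeZeros`:

  `∀ (k,f) BH, ∃ A C x₀, ∀ x ≥ x₀, ∀ z, ‖z − 1‖ ≤ 3 log log x →
     ‖Σ_{n≤x} z^{s_f(n)}‖ ≤ A·x·(log x)^{k(Re z − 1)}·exp(C‖z−1‖ log(‖z−1‖+2))`.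

DROP the clause `pairwise_not_associated` from `IsBatemanHornSystem` and the statement is FALSE: the pair
system `(X, X)` satisfies the three remaining clauses (`…SystemZeroRepulsion.Negative.pairXX_*`, p92356),
its statistic is `2 s(n)` (even), so at `z = −1` (inside the disc once `x ≥ 16`) the sum is `x + 1`, while
the claimed majorant is `A x (log x)^{−4} e^{2C log 4} = o(x)`.  So any proof of the near leaf must use
`pairwise_not_associated` — the parity symmetry `S_x(−z) = S_x(z)` of a duplicated system is exactly the
twin-type obstruction (`twinExclusion`) in its crudest form.
-/

noncomputable section

namespace Summit.Parity.BatemanHorn.Theorems.DiscMajorantLog.Negative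

open Polynomial
open Literature.NumberTheory.Sieve
open Summit.Parity.BatemanHorn.Theorems.SystemZeroRepulsion.Negative

/-- Numerics: for `x ≥ 16`, `2 ≤ 3 log log x` and `0 < log x`. [folklore] -/
theorem two_le_three_loglog_of_sixteen_le {x : ℝ} (hx : 16 ≤ x) :
    2 ≤ 3 * Real.log (Real.log x) ∧ 0 < Real.log x := by
  -- adapted from Theorems/AlmostPrimeZerosSystemZeroRepulsionNearZoneParityContent.lean
  have hlog : Real.exp 1 ≤ Real.log x := by
    have h16 : Real.log 16 = 4 * Real.log 2 := by
      rw [show (16 : ℝ) = 2 ^ 4 by norm_num, Real.log_pow]; norm_num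
    have h1 : Real.log 16 ≤ Real.log x := Real.log_le_log (by norm_num) hx
    have h2 : Real.exp 1 ≤ 4 * Real.log 2 := by
      have := Real.exp_one_lt_d9; have := Real.log_two_gt_d9; linarith
    linarith
  have hpos : 0 < Real.log x := (Real.exp_pos 1).trans_le hlog
  refine ⟨?_, hpos⟩
  have h1 : 1 ≤ Real.log (Real.log x) := by
    rw [Real.le_log_iff_exp_le hpos]; exact hlog
  linarith

/-- DROP `pairwise_not_associated` ⇒ `DiscMajorantLog` is FALSE.  Witness `k = 2`, `f = ![X, X]` (both
irreducible, leading coefficients `1 > 0`, `ω(p) = 1 < p`): `s_f(n) = 2 s(n)` is even, so `S_x(−1) = x + 1`;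
with `K := A·e^{2C log 4}` and `x := max (max x₀ 16) ⌈e^{|K|+1}⌉`, the majorant at `z = −1` gives
`(x+1)(log x)^4 ≤ K x`, hence `(log x)^4 ≤ K < |K| + 1 ≤ log x ≤ (log x)^4`. [folklore] -/
theorem discMajorantLog_false_without_pairwise_not_associated :
    ¬ ∀ (k : ℕ) (f : Fin k → ℤ[X]), (∀ i, Irreducible (f i)) → (∀ i, 0 < (f i).leadingCoeff) →
      HasNoFixedPrimeDivisor f →
      ∃ A C : ℝ, ∃ x₀ : ℕ, ∀ x : ℕ, x₀ ≤ x → ∀ z : ℂ, ‖z - 1‖ ≤ 3 * Real.log (Real.log (x : ℝ)) →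
        ‖(∑ n ∈ Finset.range (x + 1), (z : ℂ) ^ (∑ i, (((f i).eval (n : ℤ)).toNat.factorization.sum fun _ v => min v 2)))‖ ≤
          A * (x : ℝ) * (Real.log (x : ℝ)) ^ ((k : ℝ) * ((z : ℂ).re - 1)) *
            Real.exp (C * ‖(z : ℂ) - 1‖ * Real.log (‖(z : ℂ) - 1‖ + 2)) := by
  intro h
  obtain ⟨A, C, x₀, h⟩ := h 2 ![X, X] pairXX_irreducible pairXX_leadingCoeff_pos pairXX_hasNoFixedPrimeDivisor
  -- constants and a large `x`
  set E : ℝ := Real.exp (C * 2 * Real.log (2 + 2)) with hE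
  set K : ℝ := A * E with hK
  set x : ℕ := max (max x₀ 16) ⌈Real.exp (|K| + 1)⌉₊ with hxdef
  have hx₀ : x₀ ≤ x := le_trans (le_max_left _ _) (le_max_left _ _)
  have hx16 : (16 : ℝ) ≤ x := by exact_mod_cast le_trans (le_max_right x₀ 16) (le_max_left _ _)
  have hxpos : (0 : ℝ) < x := by linarith
  have hxK : Real.exp (|K| + 1) ≤ x := le_trans (Nat.le_ceil _) (by exact_mod_cast le_max_right _ _)
  obtain ⟨h23, hlogx⟩ := two_le_three_loglog_of_sixteen_le hx16
  have hlogK : |K| + 1 ≤ Real.log x := by rw [Real.le_log_iff_exp_le hxpos]; exact hxK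
  have hlog1 : 1 ≤ Real.log x := by linarith [abs_nonneg K]
  have hlog4 : Real.log x ≤ Real.log x ^ 4 := le_self_pow₀ hlog1 (by norm_num)
  -- the sum at `z = −1` is `x + 1`
  have hsum : (∑ n ∈ Finset.range (x + 1), (-1 : ℂ) ^
      (∑ i : Fin 2, ((((![X, X] : Fin 2 → ℤ[X]) i).eval (n : ℤ)).toNat.factorization.sum fun _ v => min v 2))) =
        (x : ℂ) + 1 := by
    have : ∀ n ∈ Finset.range (x + 1), (-1 : ℂ) ^
        (∑ i : Fin 2, ((((![X, X] : Fin 2 → ℤ[X]) i).eval (n : ℤ)).toNat.factorization.sum fun _ v => min v 2)) = 1 := by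
      intro n _
      rw [pairXX_exponent, pow_mul]; simp
    rw [Finset.sum_congr rfl this]; simp
  have hnorm : ‖(x : ℂ) + 1‖ = (x : ℝ) + 1 := by
    rw [show (x : ℂ) + 1 = ((x + 1 : ℕ) : ℂ) by push_cast; ring, Complex.norm_natCast]; push_cast; ring
  -- the majorant at `z = −1`
  have hz : ‖(-1 : ℂ) - 1‖ ≤ 3 * Real.log (Real.log (x : ℝ)) := by
    rw [show (-1 : ℂ) - 1 = -2 by norm_num, norm_neg, Complex.norm_two]; exact h23
  have hmain := h x hx₀ (-1) hz
  rw [hsum, hnorm, show (-1 : ℂ) - 1 = -2 by norm_num, norm_neg, Complex.norm_two] at hmain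
  have hre : ((2 : ℕ) : ℝ) * ((-1 : ℂ).re - 1) = -((4 : ℕ) : ℝ) := by simp; norm_num
  rw [hre, Real.rpow_neg hlogx.le, Real.rpow_natCast] at hmain
  -- `hmain : x + 1 ≤ A * x * (log x ^ 4)⁻¹ * E`; clear the denominator
  have hpow : 0 < Real.log (x : ℝ) ^ 4 := pow_pos hlogx 4
  have h1 : ((x : ℝ) + 1) * Real.log (x : ℝ) ^ 4 ≤ K * x := by
    have := mul_le_mul_of_nonneg_right hmain hpow.le
    rw [hK]
    calc ((x : ℝ) + 1) * Real.log (x : ℝ) ^ 4 ≤ A * x * (Real.log (x : ℝ) ^ 4)⁻¹ * E * Real.log (x : ℝ) ^ 4 := this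
      _ = A * E * x := by field_simp
  -- hence `log x ^ 4 ≤ K`, contradicting `log x ≥ |K| + 1`
  rcases le_or_gt K 0 with hK0 | hK0
  · have : ((x : ℝ) + 1) * Real.log (x : ℝ) ^ 4 ≤ 0 :=
      h1.trans (mul_nonpos_of_nonpos_of_nonneg hK0 hxpos.le)
    nlinarith
  · have h2 : Real.log (x : ℝ) ^ 4 ≤ K := by
      by_contra hcon
      push Not at hcon
      nlinarith
    have : K ≤ |K| := le_abs_self K
    linarith

end Summit.Parity.BatemanHorn.Theorems.DiscMajorantLog.Negative
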